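import Summits.ValiantsHypothesis.ValiantsHypothesis.Theorems.DivisionGapZeroOneTransferStubFormulaGridProjectionAux9
import Summits.ValiantsHypothesis.ValiantsHypothesis.Theorems.DivisionGapZeroOneTransferStubFormulaGridProjectionAux6
import Summits.ValiantsHypothesis.ValiantsHypothesis.Theorems.DivisionGapZeroOneTransferFormulaToIMM
import Literature.Computability.AlgebraicComplexity.ValiantClasses

/-!
# Crux `DivisionGap.ZeroOneTransfer` (stmt-ValiantsHypothesis-5066), line `planar-dimer-sign-elimination` —
registered stub `stub_formulaGridProjection`: FORMULAS ARE PROJECTIONS OF SQUARE-GRID DIMERS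

**Claim settled** (stub (U) of the lead's skeleton, TRUE and classical, sign-agnostic): there is a
constant `c` (here `c = 8`) such that over EVERY commutative semiring `R`, every polynomial `g` of
fan-in-two formula size `s = formulaComplexity g` is a Valiant projection (`IsProjection`: variables
of the target go to variables of `g` or to constants of `R`) of the route's grid-dimer polynomial
of the `N × N` square — the sum over fixed-point-free involutions `f` of `Fin N × Fin N` moving every
cell to a grid neighbour of `∏_v X (v, f v)` — for some `N ≤ s ^ c + c` (in fact `N ≤ 6 s + 2`).

Construction (Valiant 1979 §2 series–parallel translation of formulas; the in/out vertex splitting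
of Datta–Kulkarni–Limaye–Mahajan 2010 §4.4 turning directed paths into perfect matchings of a
bipartite planar graph; an explicit recursive layout in the square grid with odd subdivisions and
forced domino fillers), carried out in the support files
`…StubFormulaGridProjectionAux1`–`Aux9`:
matching sums on finsets (1), the two-state gadget calculus — leaf, series, attach, paths, fillers
(2), abstract parallel composition (3), grid cells / labels / fillers / the row gadget (4), series
in the grid (5), the weights of the parallel layout and the bridge to the route's encoding (6), the
parallel layout (7–9) with the closure properties of `HasGad⟦ι, R, g, n⟧` ("`g` has grid gadgets of
even size `≤ n` everywhere").  This file runs the gate-list induction of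
`…FormulaToIMM` (`hasGad_gate`, `hasGad_operand`, `hasGad_eval`: a fan-in-two formula of size `s`
has grid gadgets of size `≤ 2 · weight ≤ 6 s + 2`, the formula property entering through the
potential bound `FormulaToIMM.depthIn_output_le`), pads the root gadget to a square by dominoes and
reads the result through the bridge `msum_box_eq_routeSum`.

Unconditional (axioms `propext`, `Classical.choice`, `Quot.sound`). References: [Valiant1979] §2;
[DattaKulkarniLimayeMahajan2010] §4.4; [Burgisser2000] Def. 2.1, §2.1 (formula size).
-/

set_option linter.dupNamespace false

namespace Summit.ValiantsHypothesis.ValiantsHypothesis.Theorems.DivisionGapZeroOneTransfer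

namespace FormulaGridProjection

open Finset MvPolynomial

/-- `TwoState⟦D, W, p, q, g⟧` (a LOCAL NOTATION, deliberately not a definition): a TWO-STATE GADGET on the
vertex set `D` with ports `p ≠ q` computing `g` — the whole of `D` has matching sum `g` ("active": both
ports matched inside), `D ∖ {p, q}` has matching sum `1` ("inactive"), and `|D|` is even (so the two
mixed states have matching sum `0` by parity).  The two-attachment case of a gadget signature
(Valiant 1979 §2; DKLM 2010 §4.4). -/
local notation3 "TwoState⟦" D ", " W ", " p ", " q ", " g "⟧" =>
  p ∈ D ∧ q ∈ D ∧ p ≠ q ∧ Even (Finset.card D) ∧ msum D W = g ∧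
    msum (Finset.erase (Finset.erase D p) q) W = 1


/-- `IsLab⟦x⟧` (local notation): `x` is literally a variable `X j` or a constant `C c` — the entries
allowed in a Valiant projection (`IsProjection`). -/
local notation3 "IsLab⟦" x "⟧" => (∃ j, x = MvPolynomial.X j) ∨ ∃ c, x = MvPolynomial.C c

/-- `Adj⟦a, b⟧` (local notation): adjacency of the square grid on `ℕ × ℕ`, verbatim the four disjuncts
of the route's grid-dimer polynomial. -/
local notation3 "Adj⟦" a ", " b "⟧" =>
  (Prod.fst a + 1 = Prod.fst b ∧ Prod.snd a = Prod.snd b) ∨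
    (Prod.fst b + 1 = Prod.fst a ∧ Prod.snd a = Prod.snd b) ∨
    (Prod.fst a = Prod.fst b ∧ Prod.snd a + 1 = Prod.snd b) ∨
    (Prod.fst a = Prod.fst b ∧ Prod.snd b + 1 = Prod.snd a)

/-- `box⟦r, c, h, w⟧` (local notation): the `h × w` rectangle of cells with top-left cell `(r, c)`
(rows `r ≤ i < r + h`, columns `c ≤ j < c + w`). -/
local notation3 "box⟦" r ", " c ", " h ", " w "⟧" =>
  (Finset.Ico r (r + h) ×ˢ Finset.Ico c (c + w) : Finset (ℕ × ℕ))

/-- `Gad⟦W, r, c, h, w, g⟧` (local notation): `W` is a GRID GADGET for `g` on the rectangle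
`box⟦r, c, h, w⟧` — every dart weight is a label, non-zero weights only on darts between adjacent
cells of the rectangle, and the rectangle is a two-state gadget computing `g` with ports its
top-left and top-right cells. -/
local notation3 "Gad⟦" W ", " r ", " c ", " h ", " w ", " g "⟧" =>
  (∀ a b, IsLab⟦W a b⟧) ∧ (∀ a b, W a b ≠ 0 → a ∈ box⟦r, c, h, w⟧ ∧ b ∈ box⟦r, c, h, w⟧ ∧ Adj⟦a, b⟧) ∧
    TwoState⟦box⟦r, c, h, w⟧, W, (r, c), (r, c + w - 1), g⟧

section Formulas

open Literature.Computability.AlgebraicComplexity ArithCircuit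

variable {k : Type*} [CommSemiring k] {τ : Type*}

/-- `HasGad⟦ι, R, g, n⟧` (local notation): `g` has grid gadgets of even height and even width at most
`n` (and at least `2`) at every position of the grid. -/
local notation3 "HasGad⟦" ι ", " R ", " g ", " n "⟧" => ∃ hh ww : ℕ, hh ≤ n ∧ ww ≤ n ∧ Even hh ∧ Even ww ∧
  2 ≤ hh ∧ 2 ≤ ww ∧ ∀ r c : ℕ, ∃ W : ℕ × ℕ → ℕ × ℕ → MvPolynomial ι R, Gad⟦W, r, c, hh, ww, g⟧

/-- `tv⟦gs⟧` (local notation, as in `…FormulaToIMM`): the reduced weights of the gates of `gs`. -/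
local notation3 "tv⟦" gs "⟧" => List.foldl (fun (ts : List ℕ) (g : Gate _ _) =>
  ts ++ [(List.map (fun u => Operand.depthIn ts u + 1) (Gate.args g)).sum + 1]) [] gs

/-- Variables are labels. [folklore] -/
theorem isLab_X' (x : τ) : IsLab⟦(X x : MvPolynomial τ k)⟧ := Or.inl ⟨x, rfl⟩

/-- Constants are labels. [folklore] -/
theorem isLab_C' (a : k) : IsLab⟦(C a : MvPolynomial τ k)⟧ := Or.inr ⟨a, rfl⟩

/-- **One gate** of fan-in `≤ 2`, by cases on its operands: leaves `C 0` / `C 1` (empty sum /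
product), scaling (one-term sum), parallel (two-term sum), series (two-term product); the grid
gadget has size at most twice the weight of the gate (cf. `FormulaToIMM.hasProg_gate`). [folklore] -/
theorem hasGad_gate (vals : List (MvPolynomial τ k)) (ts : List ℕ) (g : Gate k τ)
    (hg : g.fanIn ≤ 2) (ih : ∀ u : Operand k τ, HasGad⟦τ, k, u.eval vals, 2 * (u.depthIn ts + 1)⟧) :
    HasGad⟦τ, k, g.eval vals, 2 * ((g.args.map fun u => u.depthIn ts + 1).sum + 1 + 1)⟧ := by
  cases g with
  | sum args =>
    rcases args with _ | ⟨⟨a, u⟩, _ | ⟨⟨b, v⟩, _ | ⟨w, rest⟩⟩⟩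
    · have hev : Gate.eval vals (Gate.sum ([] : List (k × Operand k τ))) = 0 := by simp [Gate.eval]
      rw [hev]
      exact hasGad_mono (hasGad_leaf (isLab_zero (ι := τ) (R := k)))
        (by simp only [Gate.args, List.map_nil, List.sum_nil]; omega)
    · have hev : Gate.eval vals (Gate.sum [(a, u)]) = C a * u.eval vals := by
        simp [Gate.eval, smul_eq_C_mul]
      rw [hev]
      exact hasGad_mono (hasGad_smul (isLab_C' a) (ih u))
        (by simp only [Gate.args, List.map_cons, List.map_nil, List.sum_cons, List.sum_nil]; omega)
    · have hev : Gate.eval vals (Gate.sum [(a, u), (b, v)]) = C a * u.eval vals + C b * v.eval vals := by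
        simp [Gate.eval, smul_eq_C_mul]
      rw [hev]
      exact hasGad_mono (hasGad_lin (isLab_C' a) (isLab_C' b) (ih u) (ih v))
        (by simp only [Gate.args, List.map_cons, List.map_nil, List.sum_cons, List.sum_nil]; omega)
    · simp [Gate.fanIn, Gate.args] at hg
  | prod args =>
    rcases args with _ | ⟨u, _ | ⟨v, _ | ⟨w, rest⟩⟩⟩
    · have hev : Gate.eval vals (Gate.prod ([] : List (Operand k τ))) = 1 := by simp [Gate.eval]
      rw [hev]
      exact hasGad_mono (hasGad_leaf (isLab_one (ι := τ) (R := k)))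
        (by simp only [Gate.args, List.map_nil, List.sum_nil]; omega)
    · have hev : Gate.eval vals (Gate.prod [u]) = u.eval vals := by simp [Gate.eval]
      rw [hev]
      exact hasGad_mono (ih u)
        (by simp only [Gate.args, List.map_cons, List.map_nil, List.sum_cons, List.sum_nil]; omega)
    · have hev : Gate.eval vals (Gate.prod [u, v]) = u.eval vals * v.eval vals := by simp [Gate.eval]
      rw [hev]
      exact hasGad_mono (hasGad_mul (ih u) (ih v))
        (by simp only [Gate.args, List.map_cons, List.map_nil, List.sum_cons, List.sum_nil]; omega)
    · simp [Gate.fanIn, Gate.args] at hg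

/-- **All gates.** Along a fan-in-two gate list, the value of every operand has grid gadgets of size
twice the operand's weight (induction along the left fold as in `FormulaToIMM.hasProg_operand`; a
junk reference is the leaf `C 0`; no formula property needed here). [folklore] -/
theorem hasGad_operand (gs : List (Gate k τ)) : (∀ g ∈ gs, g.fanIn ≤ 2) →
    ∀ u : Operand k τ, HasGad⟦τ, k, u.eval (gateValues gs), 2 * (u.depthIn tv⟦gs⟧ + 1)⟧ := by
  induction gs using List.reverseRecOn with
  | nil =>
    intro _ u
    cases u with
    | var i => exact hasGad_leaf (isLab_X' i)
    | const c => exact hasGad_leaf (isLab_C' c)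
    | gate j => exact hasGad_leaf isLab_zero
  | append_singleton gs g ih =>
    intro h2 u
    have h2' : ∀ g' ∈ gs, g'.fanIn ≤ 2 := fun g' hg' => h2 g' (List.mem_append_left _ hg')
    cases u with
    | var i => exact hasGad_leaf (isLab_X' i)
    | const c => exact hasGad_leaf (isLab_C' c)
    | gate j =>
      rw [Operand.eval_gate, Operand.depthIn.eq_3, gateValues_append_singleton,
        FormulaToIMM.tv_append_singleton]
      rcases Nat.lt_trichotomy j gs.length with hj | rfl | hj
      · rw [List.getD_append tv⟦gs⟧ _ 0 j (by rw [FormulaToIMM.tv_length]; exact hj),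
          List.getD_append (gateValues gs) _ 0 j (by simpa using hj)]
        exact ih h2' (.gate j)
      · rw [List.getD_append_right tv⟦gs⟧ _ 0 _ (by rw [FormulaToIMM.tv_length]),
          List.getD_append_right (gateValues gs) _ 0 _ (by simp), gateValues_length,
          FormulaToIMM.tv_length, Nat.sub_self]
        simpa using hasGad_gate _ _ g (h2 g (by simp)) (ih h2')
      · rw [List.getD_eq_default _ (0 : ℕ)
            (by rw [List.length_append, List.length_singleton, FormulaToIMM.tv_length]; omega),
          List.getD_eq_default _ (0 : MvPolynomial τ k) (by simp; omega)]
        exact hasGad_leaf isLab_zero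

/-- **The grid gadgets of a formula**: a fan-in-two formula `P` has grid gadgets of size at most
`6 · size + 2` (the potential bound `FormulaToIMM.depthIn_output_le` is where the formula
property enters). [folklore] -/
theorem hasGad_eval (P : ArithCircuit k τ) (hF : P.IsFormula) (h2 : P.IsFanInTwo) :
    HasGad⟦τ, k, P.eval, 2 * (3 * P.gates.length + 1)⟧ :=
  hasGad_mono (hasGad_operand P.gates h2 P.output)
    (Nat.mul_le_mul_left 2 (FormulaToIMM.depthIn_output_le P hF h2))

end Formulas


section Final

open Literature.Computability.AlgebraicComplexity ArithCircuit

/-- `HasGad⟦ι, R, g, n⟧` (local notation): `g` has grid gadgets of even height and even width at most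
`n` (and at least `2`) at every position of the grid. -/
local notation3 "HasGad⟦" ι ", " R ", " g ", " n "⟧" => ∃ hh ww : ℕ, hh ≤ n ∧ ww ≤ n ∧ Even hh ∧ Even ww ∧
  2 ≤ hh ∧ 2 ≤ ww ∧ ∀ r c : ℕ, ∃ W : ℕ × ℕ → ℕ × ℕ → MvPolynomial ι R, Gad⟦W, r, c, hh, ww, g⟧

/-- **Formulas are projections of square-grid dimers** (the content of `stub_formulaGridProjection`
with the constant `c = 8`): over any commutative semiring, a polynomial `g` of formula size
`s = formulaComplexity g` is a Valiant projection of the route's grid-dimer polynomial of the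
`N × N` square for some even `N ≤ 6 s + 2 ≤ s ^ 8 + 8`. [folklore] -/
theorem formulaGridProjection (R : Type) [CommSemiring R] (ι : Type) (g : MvPolynomial ι R) :
    ∃ N : ℕ, N ≤ (formulaComplexity g) ^ 8 + 8 ∧
      IsProjection g
        (∑ f ∈ (Finset.univ : Finset (Fin N × Fin N → Fin N × Fin N)).filter (fun f => ∀ v, f (f v) = v ∧ f v ≠ v ∧ (((v.1 : ℕ) + 1 = (f v).1 ∧ (v.2 : ℕ) = (f v).2) ∨ (((f v).1 : ℕ) + 1 = v.1 ∧ (v.2 : ℕ) = (f v).2) ∨ ((v.1 : ℕ) = (f v).1 ∧ (v.2 : ℕ) + 1 = (f v).2) ∨ ((v.1 : ℕ) = (f v).1 ∧ ((f v).2 : ℕ) + 1 = v.2))), ∏ v : Fin N × Fin N, (MvPolynomial.X (v, f v) : MvPolynomial ((Fin N × Fin N) × (Fin N × Fin N)) R)) := by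
  obtain ⟨P, hF, h2, hC, hs⟩ := ArithCircuit.exists_computes_size_eq_formulaComplexity g
  obtain ⟨hh, ww, hhn, hwn, ehh, eww, h2h, h2w, H⟩ := hasGad_eval P hF h2
  obtain ⟨W, hlab, hsupp, hT⟩ := H 0 0
  obtain ⟨ph, hph⟩ := ehh
  obtain ⟨pw, hpw⟩ := eww
  -- fill the `hh × ww` gadget up to the `N × N` square, `N = max hh ww`
  have hτ : ∀ a ∈ box⟦0, 0, max hh ww, max hh ww⟧ \ box⟦0, 0, hh, ww⟧,
      (fun v : ℕ × ℕ => if v.1 < hh then (v.1, if (v.2 + ww) % 2 = 0 then v.2 + 1 else v.2 - 1)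
        else (v.1, if v.2 % 2 = 0 then v.2 + 1 else v.2 - 1)) a ∈
          box⟦0, 0, max hh ww, max hh ww⟧ \ box⟦0, 0, hh, ww⟧ ∧
        (fun v : ℕ × ℕ => if v.1 < hh then (v.1, if (v.2 + ww) % 2 = 0 then v.2 + 1 else v.2 - 1)
          else (v.1, if v.2 % 2 = 0 then v.2 + 1 else v.2 - 1)) a ≠ a ∧
        (fun v : ℕ × ℕ => if v.1 < hh then (v.1, if (v.2 + ww) % 2 = 0 then v.2 + 1 else v.2 - 1)
          else (v.1, if v.2 % 2 = 0 then v.2 + 1 else v.2 - 1))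
          ((fun v : ℕ × ℕ => if v.1 < hh then (v.1, if (v.2 + ww) % 2 = 0 then v.2 + 1 else v.2 - 1)
            else (v.1, if v.2 % 2 = 0 then v.2 + 1 else v.2 - 1)) a) = a ∧
        Adj⟦a, (fun v : ℕ × ℕ => if v.1 < hh then (v.1, if (v.2 + ww) % 2 = 0 then v.2 + 1 else v.2 - 1)
          else (v.1, if v.2 % 2 = 0 then v.2 + 1 else v.2 - 1)) a⟧ := by
    intro a ha
    simp only [Finset.mem_sdiff, mem_box] at ha
    dsimp only
    refine ⟨?_, ?_, ?_, ?_⟩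
    · split_ifs <;>
      · simp only [Finset.mem_sdiff, mem_box]
        omega
    · intro h
      split_ifs at h <;>
      · have h1 := congrArg Prod.fst h
        have h2 := congrArg Prod.snd h
        dsimp only at h1 h2
        omega
    · split_ifs <;>
      · refine Prod.ext rfl ?_
        dsimp only
        omega
    · split_ifs <;> (dsimp only; omega)
  obtain ⟨W', hlab', hsupp', hT'⟩ := gad_fill (B := box⟦0, 0, max hh ww, max hh ww⟧) _ hlab hsupp hT
    (fun v hv => by rw [mem_box] at hv ⊢; omega) hτ
  refine ⟨max hh ww, ?_, fun d => W' ((d.1.1 : ℕ), (d.1.2 : ℕ)) ((d.2.1 : ℕ), (d.2.2 : ℕ)),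
    fun d => hlab' _ _, ?_⟩
  · -- the size bound `N ≤ 6 s + 2 ≤ s ^ 8 + 8`
    have hsz : P.size = P.gates.length := rfl
    rw [← hs, hsz]
    have hN : max hh ww ≤ 6 * P.gates.length + 2 := by omega
    refine hN.trans ?_
    rcases Nat.lt_or_ge P.gates.length 2 with hlt | hge
    · interval_cases P.gates.length <;> norm_num
    · have h7 : 2 ^ 7 ≤ P.gates.length ^ 7 := Nat.pow_le_pow_left hge 7
      calc 6 * P.gates.length + 2 ≤ 2 ^ 7 * P.gates.length := by omega
        _ ≤ P.gates.length ^ 7 * P.gates.length := Nat.mul_le_mul_right _ h7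
        _ = P.gates.length ^ 8 := by ring
        _ ≤ P.gates.length ^ 8 + 8 := Nat.le_add_right _ _
  · -- the projection identity
    rw [map_sum]
    simp only [map_prod, MvPolynomial.aeval_X]
    rw [← msum_box_eq_routeSum (max hh ww) W' (fun a b h => (hsupp' a b h).2.2), hT'.2.2.2.2.1]
    exact hC.symm

end Final

end FormulaGridProjection

open Finset MvPolynomial FormulaGridProjection Literature.Computability.AlgebraicComplexity in
/-- **Registered stub `stub_formulaGridProjection`** (crux stmt-ValiantsHypothesis-5066, line
`planar-dimer-sign-elimination`, stub (U) of the skeleton): FORMULAS ARE PROJECTIONS OF SQUARE-GRID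
DIMERS over every commutative semiring — a polynomial of fan-in-two formula size `s` is a Valiant
projection of the route's `N × N` grid-dimer polynomial for some `N ≤ s ^ c + c`, with `c = 8`
(`FormulaGridProjection.formulaGridProjection`).  Series–parallel translation of the formula
(Valiant 1979 §2), in/out vertex splitting (Datta–Kulkarni–Limaye–Mahajan 2010 §4.4), explicit grid
layout with domino fillers. [cite: Valiant1979, §2] -/
theorem stub_formulaGridProjection :
    ∃ c : ℕ, ∀ (R : Type) [CommSemiring R] (ι : Type) (g : MvPolynomial ι R),
      ∃ N : ℕ, N ≤ (formulaComplexity g) ^ c + c ∧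
        IsProjection g
          (∑ f ∈ (Finset.univ : Finset (Fin N × Fin N → Fin N × Fin N)).filter (fun f => ∀ v, f (f v) = v ∧ f v ≠ v ∧ (((v.1 : ℕ) + 1 = (f v).1 ∧ (v.2 : ℕ) = (f v).2) ∨ (((f v).1 : ℕ) + 1 = v.1 ∧ (v.2 : ℕ) = (f v).2) ∨ ((v.1 : ℕ) = (f v).1 ∧ (v.2 : ℕ) + 1 = (f v).2) ∨ ((v.1 : ℕ) = (f v).1 ∧ ((f v).2 : ℕ) + 1 = v.2))), ∏ v : Fin N × Fin N, (MvPolynomial.X (v, f v) : MvPolynomial ((Fin N × Fin N) × (Fin N × Fin N)) R)) :=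
  ⟨8, fun R _ ι g => formulaGridProjection R ι g⟩

end Summit.ValiantsHypothesis.ValiantsHypothesis.Theorems.DivisionGapZeroOneTransfer
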